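import Summits.ValiantsHypothesis.ValiantsHypothesis.Theorems.LacunarySymmetroidMatrixDescartesFanLaw
import Summits.ValiantsHypothesis.ValiantsHypothesis.Theorems.LacunarySymmetroidMatrixDescartesOneAlternation
import Summits.ValiantsHypothesis.ValiantsHypothesis.Theorems.LacunarySymmetroidMatrixDescartesCensusFatSectors

/-!
# `MatrixDescartes` (stmt-ValiantsHypothesis-18050) — the FAN SECTOR in the crux's own currency:
# `MatrixDescartes`' inequality holds on fan words at every admissible size (fat formats included)

HONEST FRAMING.  Cell `pub-symmetroid`, seat `val-sym-mdr-p2` (gen 2; docket «format-level upper bounds at fat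
formats via sign structure»); helper `--supports` the crux `Theses.LacunarySymmetroid.MatrixDescartes`, NO closure
claim.  The crux quantifies over ALL real symmetric lacunary pencils `∑ₗ X^{dₗ} Sₗ`; this file proves its inequality
`Z^q ≤ 2^(K⌊log₂K⌋)` (for `K ≥ K₀(c,q)`, all `m ≤ 2^((⌊log₂K⌋+c)^c)`) on the SECTOR OF FAN WORDS: one letter
`S_{lp}` (the pivot) is an arbitrary symmetric matrix, every other letter is positive semidefinite, ONE letter `l₀` lies
on one side of the pivot exponent and all remaining letters on the other side with strictly smaller gaps
`|dₗ − d_{lp}| < |d_{l₀} − d_{lp}|`, and the non-pivot exponents have one parity (so that `F(−X)` is again a fan word).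
On that sector `Z₊ ≤ 2m` (`fanWord_posRoots_le`, from `…FanLaw.lean`), `Z ≤ 4m + 1` (`fanWord_realRoots_le`, with the
tree's `stub_negRoots`), hence the crux's inequality at every fat format (`fanWord_mdr`, via `Census.fatFormat_absorb`).
This is a K-free law by SIGN/EXPONENT STRUCTURE (not by parameter count: the sector has `≈ K·m²/2` free parameters,
like the full format).  Nothing here bears on pencils outside the sector, on `stub_twoSided`, on `DoorA26`/`DoorA34`,
or on `VP ≠ VNP`.  [folklore] bookkeeping over the companion files.
-/

-- layout Summits/ValiantsHypothesis/ValiantsHypothesis forces the duplicated namespace component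
set_option linter.dupNamespace false

namespace Summit.ValiantsHypothesis.ValiantsHypothesis.Theorems.LacunarySymmetroidMatrixDescartes

open Polynomial Matrix Finset FanLaw
open scoped BigOperators

namespace FanLawMDR

/-- Splitting a `Fin K`-indexed pencil at a pivot index `lp`: `∑ₗ X^{dₗ} Sₗ = X^{d lp} S_{lp} + ∑_{l ≠ lp} X^{dₗ} Sₗ`
(the remaining letters indexed by the subtype `{l // l ≠ lp}`). [folklore] -/
theorem pencil_split {K m : ℕ} (d : Fin K → ℕ) (S : Fin K → Matrix (Fin m) (Fin m) ℝ) (lp : Fin K) :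
    ∑ l, ((Polynomial.X : Polynomial ℝ) ^ d l) • (S l).map Polynomial.C
      = ((Polynomial.X : Polynomial ℝ) ^ d lp) • (S lp).map Polynomial.C
        + ∑ l : {l // l ≠ lp}, ((Polynomial.X : Polynomial ℝ) ^ d l.1) • (S l.1).map Polynomial.C := by
  rw [← Finset.add_sum_erase _ _ (Finset.mem_univ lp),
    Finset.sum_subtype (Finset.univ.erase lp) (p := fun l => l ≠ lp) (fun l => by simp [Finset.mem_erase])]

end FanLawMDR

/-- **Fan words, positive zeros.**  `∑ₗ X^{dₗ} Sₗ` (`K` letters, `m × m`), pivot index `lp` with `S lp` symmetric,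
all other letters `⪰ 0`, a lone letter `l₀ ≠ lp` on one side of `d lp` and the rest on the other side with strictly
smaller gaps ⇒ at most `2m` distinct positive zeros of the determinant, for every `K`. [folklore] -/
theorem fanWord_posRoots_le (K m : ℕ) (d : Fin K → ℕ) (S : Fin K → Matrix (Fin m) (Fin m) ℝ) (lp l₀ : Fin K)
    (hne : l₀ ≠ lp) (hS : (S lp).IsSymm) (hpsd : ∀ l, l ≠ lp → (S l).PosSemidef)
    (hfan : (d l₀ < d lp ∧ ∀ l, l ≠ lp → l ≠ l₀ → d lp < d l ∧ d l - d lp < d lp - d l₀)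
      ∨ (d lp < d l₀ ∧ ∀ l, l ≠ lp → l ≠ l₀ → d l < d lp ∧ d lp - d l < d l₀ - d lp)) :
    ((Matrix.det (∑ l, ((Polynomial.X : Polynomial ℝ) ^ d l) • (S l).map Polynomial.C)).roots.toFinset.filter
        (fun t => 0 < t)).card ≤ 2 * m := by
  classical
  rw [FanLawMDR.pencil_split d S lp]
  have hP : ∀ l : {l // l ≠ lp}, (S l.1).PosSemidef := fun l => hpsd l.1 l.2
  rcases hfan with ⟨hlow, h⟩ | ⟨hup, h⟩
  · have := fanLaw_lower (κ := {l // l ≠ lp}) (d lp) (fun l => d l.1) (S lp) (fun l => S l.1) ⟨l₀, hne⟩ hS hP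
      hlow fun l hl => h l.1 l.2 fun hll => hl (Subtype.ext hll)
    simpa using this
  · have := fanLaw_upper (κ := {l // l ≠ lp}) (d lp) (fun l => d l.1) (S lp) (fun l => S l.1) ⟨l₀, hne⟩ hS hP
      hup fun l hl => h l.1 l.2 fun hll => hl (Subtype.ext hll)
    simpa using this

/-- **Fan words, all real zeros.**  If moreover the non-pivot exponents all have the same parity, then `F(−X)` is
again a fan word (the letters pick up the signs `(−1)^{dₗ}`), so `det F` has at most `4m + 1` distinct real zeros
(positive zeros of `F` and of `F(−X)`, and the origin: tree `stub_negRoots`). [folklore] -/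
theorem fanWord_realRoots_le (K m : ℕ) (d : Fin K → ℕ) (S : Fin K → Matrix (Fin m) (Fin m) ℝ) (lp l₀ : Fin K)
    (hne : l₀ ≠ lp) (hS : (S lp).IsSymm) (hpsd : ∀ l, l ≠ lp → (S l).PosSemidef)
    (hfan : (d l₀ < d lp ∧ ∀ l, l ≠ lp → l ≠ l₀ → d lp < d l ∧ d l - d lp < d lp - d l₀)
      ∨ (d lp < d l₀ ∧ ∀ l, l ≠ lp → l ≠ l₀ → d l < d lp ∧ d lp - d l < d l₀ - d lp))
    (hpar : (∀ l, l ≠ lp → Even (d l)) ∨ (∀ l, l ≠ lp → Odd (d l))) :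
    (Matrix.det (∑ l, ((Polynomial.X : Polynomial ℝ) ^ d l) • (S l).map Polynomial.C)).roots.toFinset.card
      ≤ 4 * m + 1 := by
  have h1 := fanWord_posRoots_le K m d S lp l₀ hne hS hpsd hfan
  have h3 := stub_negRoots K m d S
  -- the reflected word
  have h2 : ((Matrix.det (∑ l, ((Polynomial.X : Polynomial ℝ) ^ d l) •
      (((-1 : ℝ) ^ d l) • S l).map Polynomial.C)).roots.toFinset.filter (fun t => 0 < t)).card ≤ 2 * m := by
    rcases hpar with hev | hodd
    · refine fanWord_posRoots_le K m d (fun l => ((-1 : ℝ) ^ d l) • S l) lp l₀ hne (hS.smul _)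
        (fun l hl => ?_) hfan
      simp only [(hev l hl).neg_one_pow, one_smul]
      exact hpsd l hl
    · rw [← roots_det_pencil_neg d (fun l => ((-1 : ℝ) ^ d l) • S l)]
      refine fanWord_posRoots_le K m d (fun l => -(((-1 : ℝ) ^ d l) • S l)) lp l₀ hne (hS.smul _).neg
        (fun l hl => ?_) hfan
      simp only [(hodd l hl).neg_one_pow, neg_smul, one_smul, neg_neg]
      exact hpsd l hl
  omega

/-- **`MatrixDescartes` holds on the fan sector, at every fat format.**  For all `c, q` there is `K₀` such that for
all `K ≥ K₀`, all `m ≤ 2^((⌊log₂K⌋+c)^c)`, all exponents `d` and all real `m × m` letters `Sₗ` forming a fan word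
(pivot index `lp` with `S lp` symmetric, all other letters `⪰ 0`, a lone letter `l₀` on one side of `d lp`, the rest
on the other side with strictly smaller gaps, non-pivot exponents of one parity), the number `Z` of distinct real
zeros of `det (∑ₗ X^{dₗ} Sₗ)` satisfies `Z^q ≤ 2^(K⌊log₂K⌋)` — the crux's inequality, restricted to this sector and
proved there unconditionally.  Nothing is claimed outside the sector. [folklore] -/
theorem fanWord_mdr (c q : ℕ) : ∃ K₀ : ℕ, ∀ K m : ℕ, K₀ ≤ K → m ≤ 2 ^ ((Nat.log 2 K + c) ^ c) →
    ∀ (d : Fin K → ℕ) (S : Fin K → Matrix (Fin m) (Fin m) ℝ) (lp l₀ : Fin K), l₀ ≠ lp → (S lp).IsSymm →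
      (∀ l, l ≠ lp → (S l).PosSemidef) →
      ((d l₀ < d lp ∧ ∀ l, l ≠ lp → l ≠ l₀ → d lp < d l ∧ d l - d lp < d lp - d l₀)
        ∨ (d lp < d l₀ ∧ ∀ l, l ≠ lp → l ≠ l₀ → d l < d lp ∧ d lp - d l < d l₀ - d lp)) →
      ((∀ l, l ≠ lp → Even (d l)) ∨ (∀ l, l ≠ lp → Odd (d l))) →
      (Matrix.det (∑ l, ((Polynomial.X : Polynomial ℝ) ^ d l) • (S l).map Polynomial.C)).roots.toFinset.card ^ q
        ≤ 2 ^ (K * Nat.log 2 K) := by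
  obtain ⟨K₀, hK₀⟩ := Census.fatFormat_absorb 2 c q
  refine ⟨K₀, fun K m hK hm d S lp l₀ hne hS hpsd hfan hpar => hK₀ K m _ hK hm ?_⟩
  have h := fanWord_realRoots_le K m d S lp l₀ hne hS hpsd hfan hpar
  have : 4 * m + 1 ≤ 2 ^ 2 * (m + 1) * (K + 1) := by nlinarith
  exact h.trans this

end Summit.ValiantsHypothesis.ValiantsHypothesis.Theorems.LacunarySymmetroidMatrixDescartes
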